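import Mathlib
import Summits.KontsevichZagierPeriods.Zeta5Search.BigPrimePoles
import Summits.KontsevichZagierPeriods.Zeta5Search.ExcessWindowLemmas
import HarnessLib

/-!
# ζ(5) search — the dual polynomial `M_b ∈ 𝔽_p[X]` of `F̃₇(b)` and Wilson duality at the poles

Cell `pub-zeta5` (HONEST FRAMING: systematic search; no irrationality claim unless certified), typer seat
generation 7; the `𝔽_p` half of the Lean proof of the big-prime divisibility theorem (W∞)/(U∞) of the gen-2 seat
(REPORT-gen2-g5 §5f; theorems in `Zeta5Search/BigPrimeDivisibility.lean`, `ℚ`/`ℤ` half in `BigPrimePoles.lean`,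
finite-field lemmas in `ExcessWindowLemmas.lean`).  OUR construction, not a cited fact; no irrationality content.

With `n = b₀ < p`, lower parameters `β_j = b_j` (`2β_j ≤ n`) and blocks `B_j = [β_j, n − β_j]`:
* `prod_univ_X_add_C`: `∏_{u ∈ 𝔽_p} (X + u) = X^p − X`; `taylor_X_pow_card_sub_X`: it is translation invariant;
  `sum_taylor_coeff_eq_zero`: `Σ_{x∈𝔽_p} [X^r] M(X+x) = 0` for `r < p`, `deg M < r + (r+1)(p−1)` (gen-2's power-sum
  lemma in Hasse–Taylor form).
* `MF p n β = (2X + n) · ∏_{s≤n}(X+s) · ∏_{j<7} ∏_{u ∈ 𝔽_p ∖ B̄_j}(X+u)` — the DUAL POLYNOMIAL (`pall`, `KF`, `blockF`).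
* `pall_mul_KF`, **`pall_pow_mul_MF`**: `(∏_{s≤n}(X+s))^6 · M_b = numR · (X^p − X)^7` — Wilson duality turns each
  reciprocal block `1/∏_{s∈B_j}(X+s)` into the complementary polynomial block.
* `taylor_pall`, **`zZ_cast`**: at each pole `q₀ ≤ n` (`5 ≤ p`), the integer Taylor numerators of `BigPrimePoles`
  reduce to `z_{q₀,i} ≡ −e₀(q₀)^6 · [X^{i+1}] M_b(X − q₀) (mod p)` for `i < 4` (shift, cancel `X^7`, and
  `(X^{p−1} − 1)^7 ≡ −1 (mod X^{p−1})`).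
-/

noncomputable section

open Finset Polynomial

namespace Summit.KontsevichZagierPeriods.Zeta5Search.BigPrime

/-! ### The 𝔽_p side: Wilson duality at the poles -/

section ModP

variable {p : ℕ} [hp : Fact p.Prime]

open Summit.KontsevichZagierPeriods.Zeta5Search.ExcessWindow (prod_X_sub_C_eq
  sum_eval_iterate_derivative_eq_zero)

/-- `∏_{u ∈ 𝔽_p} (X + u) = X^p − X`. -/
theorem prod_univ_X_add_C : ∏ u : ZMod p, (X + C u) = X ^ p - X := by
  rw [← prod_X_sub_C_eq p]
  exact Fintype.prod_equiv (Equiv.neg (ZMod p)) _ _ fun a => by simp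

/-- `X^p − X` is invariant under the translations of `𝔽_p`. -/
theorem taylor_X_pow_card_sub_X (c : ZMod p) : taylor c (X ^ p - X : (ZMod p)[X]) = X ^ p - X := by
  rw [map_sub, taylor_X_pow, taylor_X, add_pow_char, ← C_pow, ZMod.pow_card]
  ring

/-- Power sums of Hasse–Taylor coefficients: `Σ_{x ∈ 𝔽_p} [ε^r] M(x + ε) = 0` for `r < p` and
`deg M < r + (r+1)(p−1)` (gen-2's `sum_eval_iterate_derivative_eq_zero`, divided by the unit `r!`). -/
theorem sum_taylor_coeff_eq_zero (M : (ZMod p)[X]) (r : ℕ) (hr : r < p)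
    (hM : M.natDegree < r + (r + 1) * (p - 1)) :
    ∑ x : ZMod p, (taylor x M).coeff r = 0 := by
  have h := sum_eval_iterate_derivative_eq_zero p r M hM
  have hfac : ∀ x : ZMod p,
      ((derivative^[r]) M).eval x = (r.factorial : ZMod p) * (taylor x M).coeff r := by
    intro x
    rw [taylor_coeff, ← factorial_smul_hasseDeriv, LinearMap.smul_apply, eval_smul, nsmul_eq_mul]
  simp_rw [hfac] at h
  rw [← mul_sum] at h
  have hunit : (r.factorial : ZMod p) ≠ 0 := by
    rw [Ne, ZMod.natCast_eq_zero_iff, hp.out.dvd_factorial]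
    omega
  exact (mul_eq_zero.1 h).resolve_left hunit

variable (p)

/-- The image in `𝔽_p` of the block `[β, n − β]`. -/
def blockF (n β : ℕ) : Finset (ZMod p) := (block n β).image (Nat.cast : ℕ → ZMod p)

/-- The COMPLEMENTARY block polynomial `K_β = ∏_{u ∈ 𝔽_p ∖ block} (X + u)`. -/
def KF (n β : ℕ) : (ZMod p)[X] := ∏ u ∈ univ \ blockF p n β, (X + C u)

/-- All the pole factors: `P = ∏_{s ≤ n} (X + s)`. -/
def pall (n : ℕ) : (ZMod p)[X] := ∏ s ∈ range (n + 1), (X + C (s : ZMod p))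

/-- The DUAL POLYNOMIAL `M_b = (2X + n) · ∏_{s ≤ n} (X + s) · ∏_{j<7} K_{β_j} ∈ 𝔽_p[X]`. -/
def MF (n : ℕ) (β : ℕ → ℕ) : (ZMod p)[X] :=
  (C 2 * X + C (n : ZMod p)) * pall p n * ∏ j ∈ range 7, KF p n (β j)

variable {p}

/-- Blocks consist of pole indices: `[β, n − β] ⊆ [0, n]`. -/
theorem block_subset (n β : ℕ) : block n β ⊆ range (n + 1) := by
  intro s hs
  rw [block, mem_Icc] at hs
  rw [mem_range]
  omega

/-- For `n < p` the pole indices `0, …, n` have distinct residues modulo `p`. -/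
theorem cast_injOn_range {n : ℕ} (hn : n < p) :
    Set.InjOn (Nat.cast : ℕ → ZMod p) (range (n + 1) : Finset ℕ) := by
  intro a ha b hb hab
  have ha' : a < n + 1 := by simpa using ha
  have hb' : b < n + 1 := by simpa using hb
  have h := (ZMod.natCast_eq_natCast_iff' a b p).1 hab
  rwa [Nat.mod_eq_of_lt (by omega), Nat.mod_eq_of_lt (by omega)] at h

/-- Wilson duality for one block: `P · K_β = (∏_{s ∈ [0,n] ∖ block} (X + s)) · (X^p − X)`. -/
theorem pall_mul_KF {n : ℕ} (hn : n < p) (β : ℕ) :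
    pall p n * KF p n β =
      (∏ s ∈ range (n + 1) \ block n β, (X + C (s : ZMod p))) * (X ^ p - X) := by
  have hsub := block_subset n β
  have h1 : pall p n = (∏ s ∈ range (n + 1) \ block n β, (X + C (s : ZMod p))) *
      ∏ s ∈ block n β, (X + C (s : ZMod p)) := by
    rw [pall, prod_sdiff hsub]
  have h2 : ∏ s ∈ block n β, (X + C (s : ZMod p)) = ∏ u ∈ blockF p n β, (X + C u) := by
    rw [blockF, prod_image ((cast_injOn_range hn).mono (by exact_mod_cast hsub))]
  have h3 : (∏ u ∈ blockF p n β, (X + C u)) * KF p n β = X ^ p - X := by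
    rw [KF, mul_comm, prod_sdiff (subset_univ _), prod_univ_X_add_C]
  rw [h1, mul_assoc, h2, h3]

/-- **Wilson duality for the summand**: `P^6 · M_b = numR · (X^p − X)^7` in `𝔽_p[X]`. -/
theorem pall_pow_mul_MF {n : ℕ} (hn : n < p) (β : ℕ → ℕ) :
    pall p n ^ 6 * MF p n β = numR (ZMod p) n β * (X ^ p - X) ^ 7 := by
  have hkey : pall p n ^ 7 * ∏ j ∈ range 7, KF p n (β j) =
      (∏ j ∈ range 7, ∏ s ∈ range (n + 1) \ block n (β j), (X + C (s : ZMod p))) *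
        (X ^ p - X) ^ 7 := by
    rw [show pall p n ^ 7 = ∏ _j ∈ range 7, pall p n by simp, ← prod_mul_distrib,
      prod_congr rfl fun j _ => pall_mul_KF hn (β j), prod_mul_distrib]
    simp
  rw [MF, numR, show pall p n ^ 6 * ((C 2 * X + C (n : ZMod p)) * pall p n * ∏ j ∈ range 7, KF p n (β j)) =
    (C 2 * X + C (n : ZMod p)) * (pall p n ^ 7 * ∏ j ∈ range 7, KF p n (β j)) by ring, hkey]
  ring

/-- Shift of the pole factors to the pole `q₀`: `P(X − q₀) = X · ∏_{s ≠ q₀} (X + (s − q₀))`. -/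
theorem taylor_pall {n : ℕ} (q₀ : ℕ) (hq₀ : q₀ ≤ n) :
    taylor (-((q₀ : ℕ) : ZMod p)) (pall p n) =
      X * ∏ s ∈ (range (n + 1)).erase q₀, (X + C ((s : ZMod p) - q₀)) := by
  have hmem : q₀ ∈ range (n + 1) := mem_range.2 (by omega)
  rw [pall, taylor_prod', ← mul_prod_erase _ _ hmem]
  congr 1
  · rw [taylor_X_add_C, add_neg_cancel, C_0, add_zero]
  · refine prod_congr rfl fun s _ => ?_
    rw [taylor_X_add_C, sub_eq_add_neg]

/-- **The shifted congruence.**  At every pole `q₀ ≤ n` the integer `z_{q₀,i}` reduces modulo `p` to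
`−e₀(q₀)^6 · [X^{i+1}] M_b(X − q₀)` for `i < 4` (`p ≥ 5`). -/
theorem zZ_cast (hp5 : 5 ≤ p) {n : ℕ} (hn : n < p) (β : ℕ → ℕ) (q₀ : ℕ) (hq₀ : q₀ ≤ n)
    {i : ℕ} (hi : i < 4) :
    ((zZ n β q₀ i : ℤ) : ZMod p) =
      -(((e0Z n q₀ : ℤ) : ZMod p) ^ 6) * (taylor (-((q₀ : ℕ) : ZMod p)) (MF p n β)).coeff (i + 1) := by
  set NF := taylor (-((q₀ : ℕ) : ZMod p)) (numR (ZMod p) n β) with hNF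
  set EF := ER (ZMod p) n q₀ with hEF
  set JF := truncInv EF 6 with hJF
  -- `X ∣ M_b(X − q₀)`
  have hX : (X : (ZMod p)[X]) ∣ taylor (-((q₀ : ℕ) : ZMod p)) (MF p n β) := by
    rw [MF, taylor_mul, taylor_mul, taylor_pall q₀ hq₀]
    exact ((dvd_mul_right X _).mul_left _).mul_right _
  obtain ⟨Mt, hMt⟩ := hX
  -- the shifted Wilson identity and cancellation of `X^7`
  have hshift := congrArg (taylor (-((q₀ : ℕ) : ZMod p))) (pall_pow_mul_MF hn β)
  simp only [taylor_mul, taylor_pow, taylor_pall q₀ hq₀, taylor_X_pow_card_sub_X, hMt] at hshift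
  have hXp : (X ^ p - X : (ZMod p)[X]) = X * (X ^ (p - 1) - 1) := by
    have h : (X : (ZMod p)[X]) ^ p = X * X ^ (p - 1) := by
      rw [← pow_succ', Nat.sub_add_cancel hp.out.one_le]
    rw [h]; ring
  rw [hXp] at hshift
  have hcancel : EF * Mt = NF * (X ^ (p - 1) - 1) ^ 7 := by
    have h7 : (X : (ZMod p)[X]) ^ 7 ≠ 0 := pow_ne_zero _ X_ne_zero
    apply mul_left_cancel₀ h7
    rw [hEF, ER, prod_pow, hNF]
    linear_combination hshift
  -- congruence modulo `X^4`
  have hY : (X : (ZMod p)[X]) ^ (p - 1) ∣ (X ^ (p - 1) - 1) ^ 7 + 1 := by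
    have := sub_dvd_pow_sub_pow (X ^ (p - 1) - 1 : (ZMod p)[X]) (-1) 7
    rw [sub_neg_eq_add, sub_add_cancel] at this
    refine this.trans (dvd_of_eq ?_)
    ring
  have h4 : (X : (ZMod p)[X]) ^ 4 ∣ X ^ (p - 1) := pow_dvd_pow X (by omega)
  have hA : (X : (ZMod p)[X]) ^ 4 ∣ EF * Mt + NF := by
    rw [hcancel, show NF * (X ^ (p - 1) - 1) ^ 7 + NF = NF * ((X ^ (p - 1) - 1) ^ 7 + 1) by ring]
    exact (h4.trans hY).mul_left _
  have hB : (X : (ZMod p)[X]) ^ 4 ∣ (EF * JF - C (EF.coeff 0 ^ 6)) * Mt :=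
    ((pow_dvd_pow X (by norm_num : 4 ≤ 6)).trans (truncInv_spec EF 6)).mul_right _
  have hC : (X : (ZMod p)[X]) ^ 4 ∣ NF * JF - (-C (EF.coeff 0 ^ 6) * Mt) := by
    have : NF * JF - (-C (EF.coeff 0 ^ 6) * Mt) =
        (EF * Mt + NF) * JF - (EF * JF - C (EF.coeff 0 ^ 6)) * Mt := by
      ring
    rw [this]
    exact dvd_sub (hA.mul_right _) hB
  have hcoeff := coeff_eq_of_X_pow_dvd_sub hC hi
  -- identify both sides
  have he0 : EF.coeff 0 = ((e0Z n q₀ : ℤ) : ZMod p) := by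
    rw [hEF, ← ER_map (Int.castRingHom (ZMod p)), coeff_map, ER_coeff_zero]; simp
  have hL : NF * JF = (taylor (-(q₀ : ℤ)) (numR ℤ n β) * truncInv (ER ℤ n q₀) 6).map
      (Int.castRingHom (ZMod p)) := by
    rw [Polynomial.map_mul, map_taylor, numR_map, truncInv_map, ER_map]
    simp [hNF, hJF, hEF]
  have hMt' : Mt.coeff i = (taylor (-((q₀ : ℕ) : ZMod p)) (MF p n β)).coeff (i + 1) := by
    rw [hMt, coeff_X_mul]
  rw [hL, coeff_map, he0, neg_mul, coeff_neg, coeff_C_mul, hMt'] at hcoeff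
  have hz : ((zZ n β q₀ i : ℤ) : ZMod p) = (Int.castRingHom (ZMod p))
      ((taylor (-(q₀ : ℤ)) (numR ℤ n β) * truncInv (ER ℤ n q₀) 6).coeff i) := by
    simp [zZ]
  rw [hz, hcoeff]
  ring

end ModP

end Summit.KontsevichZagierPeriods.Zeta5Search.BigPrime

end
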